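import Summits.AtomisticToContinuum.Crystallization.Theorems.ChartedZeroExcessLayeredLatticeLiouvilleZZX

/-!
# Charted zero-excess layered lattices — Part ZZY: rider R1 «WINDOW CONNECTIVITY» — the level surface and direction chains (part 2 of 3)

Route `ChartedPlanarOrder`, station L2′, lineage `stmt-AtomisticToContinuum-26636`; sequel of Part ZZX (the steering walks).
This part DISCHARGES the last rider `WindowConnected S K Ψ τ` of the (B′.5) skeleton `slabIso_package` (Part ZZU) from binders
the skeleton already carries: the global S-chart `hΨ`, `hsurjΨ`, two-shell cleanliness `hclean`, the container data
`K.Finite`, `K.Nonempty`, `K ⊆ B̄(x₀, 4)`, and local finiteness `hfin` of the charted sites within `43/2` of `K`.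
NO sheet flatness, NO covering radius, NO nearest-atom snapping (critic row 1499 (B), variant (R1-rad) with waypoints
that are POINTS OF SPACE on the level surface, reached by the greedy walk of Part ZZX).

## The argument (potential `φ = d(·, K)`, record band dial `M = 71/5` for both windows)

1. RADIAL SLOPE (ZZY-1): along every ray from `x₀`, beyond radius `10`, `φ` grows at rate `≥ 4/5`
   (`d(x₀ + (ρ+δ)u, k) ≥ d(x₀ + ρu, k) + 4δ/5` for `‖u‖ = 1`, `ρ ≥ 10`, `d(k, x₀) ≤ 4`: squared-distance algebra).
2. LEVEL POINTS (ZZY-2): every ray meets the level surface `{φ = M}` (intermediate value theorem, `φ(x₀) ≤ 4 < M`), at radius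
   in `[M − 4, M + 4]`; level points on rays `u, v` are `≤ (9/4)·ρ_u·‖u − v‖` apart (slope + `φ` is `1`-Lipschitz); an atom with
   potential in `(M, M + 17/16]` is within `85/64` of the level point on its own ray (the HOP).
3. DIRECTIONS (ZZY-3): for unit `a, b` with `⟪a, b⟫ ≥ −3/5` the normalised linear interpolation is a chain of unit vectors with
   steps `≤ 10/N` (`‖(1−s)a + sb‖ ≥ 2/5`; normalisation is `2/‖·‖`-Lipschitz); any two unit vectors are joined through a MID
   direction `w` with `⟪u, w⟫, ⟪w, v⟫ ≥ −3/5` (`w = v`, or `(u+v)/‖u+v‖`, or a unit vector orthogonal to `u` when `v = −u`).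
4. LEG (ZZY-4): from a window site within `85/64` of a level point on ray `a`, follow the direction chain to ray `b`: at each
   waypoint the greedy walk of Part ZZX (`exists_path_toward_point`, start distance `≤ 85/64 + 1 = 149/64`) reaches a site within
   `17/16 ≤ 85/64` of the next level point; all inside the window since `lo + 149/64 ≤ M ≤ hi − 149/64`.
5. ASSEMBLY (ZZY-5): `y, x ∈ window (lo, hi)`: walk both to the band `(M, M + 17/16]` (`exists_path_to_band`), HOP to the level
   surface, two LEGS through the mid direction, a final greedy walk toward the POINT `Ψ x′` (start distance `≤ 85/32`) and the
   one-bond last hop (`reflTransGen_of_dist_le`); reverse `x`'s band walk (Barlow adjacency is symmetric).  Dials: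
   `8 ≤ lo`, `14 ≤ M`, `lo + 85/32 ≤ M`, `M + 119/32 ≤ hi ≤ 43/2` — met by `M = 71/5` for `W = (81/8, 155/8)` and `W′ = (179/16, 293/16)`.

THIS FILE: steps 1–3 (ZZY-1 radial slope, ZZY-2 level points and the hop, ZZY-3 direction chains); Part ZZZ: steps 4–5 (the leg and the
assembly ★★ `windowConnected : … → WindowConnected S K Ψ τ` in the binder shape of `slabIso_package`).  Split for the 400-line cap.
0 sorry; standard axioms; no decide; no definitions.
-/

noncomputable section
open scoped RealInnerProductSpace
open Literature.Geometry.DiscreteGeometry (IsTwoShellGoodSet)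
open Summit.AtomisticToContinuum.Crystallization.Theorems.ChartedPlanarOrderRigidityDoor (E3)

namespace Summit.AtomisticToContinuum.Crystallization.Theorems.ChartedZeroExcessLayeredLatticeLiouville

/-! ### ZZY-1  Radial slope of the potential -/

/-- ★ RADIAL SLOPE: beyond radius `10` about `x₀`, moving outward along a ray by `δ` increases the distance to every point within
`4` of `x₀` by at least `4δ/5`. -/
theorem radial_slope {x₀ k u : E3} (hu : ‖u‖ = 1) (hk : dist k x₀ ≤ 4) {ρ δ : ℝ} (hρ : 10 ≤ ρ) (hδ : 0 ≤ δ) :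
    dist (x₀ + ρ • u) k + 4 / 5 * δ ≤ dist (x₀ + (ρ + δ) • u) k := by
  set w := k - x₀ with hw
  have hwn : ‖w‖ ≤ 4 := by rwa [hw, ← dist_eq_norm]
  have hs : |⟪w, u⟫| ≤ 4 := (abs_real_inner_le_norm w u).trans (by rw [hu, mul_one]; exact hwn)
  have ha : x₀ + ρ • u - k = ρ • u - w := by rw [hw]; abel
  have hb : x₀ + (ρ + δ) • u - k = (ρ • u - w) + δ • u := by rw [hw, add_smul]; abel
  rw [dist_eq_norm, dist_eq_norm, ha, hb]
  have huu : ⟪u, u⟫ = 1 := by rw [real_inner_self_eq_norm_sq, hu, one_pow]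
  have hD2 : ‖ρ • u - w‖ ^ 2 = ρ ^ 2 - 2 * ρ * ⟪w, u⟫ + ‖w‖ ^ 2 := by
    rw [norm_sub_sq_real, norm_smul, Real.norm_of_nonneg (by linarith), hu, mul_one, real_inner_smul_left,
      real_inner_comm, ← real_inner_comm w u]
    ring
  have hN2 : ‖(ρ • u - w) + δ • u‖ ^ 2 = ‖ρ • u - w‖ ^ 2 + 2 * δ * (ρ - ⟪w, u⟫) + δ ^ 2 := by
    rw [norm_add_sq_real, norm_smul, Real.norm_of_nonneg hδ, hu, mul_one, real_inner_smul_right, inner_sub_left,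
      real_inner_smul_left, huu]
    ring
  have h45 : 4 / 5 * ‖ρ • u - w‖ ≤ ρ - ⟪w, u⟫ := by
    have hsq : (4 / 5 * ‖ρ • u - w‖) ^ 2 ≤ (ρ - ⟪w, u⟫) ^ 2 := by
      rw [mul_pow, hD2]
      nlinarith [abs_le.1 hs, hwn, norm_nonneg w,
        mul_nonneg (by linarith [abs_le.1 hs] : (0 : ℝ) ≤ ρ - ⟪w, u⟫ - 6)
          (by linarith [abs_le.1 hs] : (0 : ℝ) ≤ ρ - ⟪w, u⟫ - 6)]
    exact (pow_le_pow_iff_left₀ (by positivity) (by linarith [abs_le.1 hs]) two_ne_zero).1 hsq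
  have hsq : (‖ρ • u - w‖ + 4 / 5 * δ) ^ 2 ≤ ‖(ρ • u - w) + δ • u‖ ^ 2 := by
    rw [hN2]; nlinarith [norm_nonneg (ρ • u - w)]
  exact (pow_le_pow_iff_left₀ (by positivity) (norm_nonneg _) two_ne_zero).1 hsq

/-- the potential form: `φ(x₀ + (ρ+δ)u) ≥ φ(x₀ + ρu) + 4δ/5` (finite nonempty container within `4` of `x₀`). -/
theorem infDist_radial_slope {K : Set E3} {x₀ u : E3} (hKfin : K.Finite) (hKne : K.Nonempty)
    (hK : ∀ k ∈ K, dist k x₀ ≤ 4) (hu : ‖u‖ = 1) {ρ δ : ℝ} (hρ : 10 ≤ ρ) (hδ : 0 ≤ δ) :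
    Metric.infDist (x₀ + ρ • u) K + 4 / 5 * δ ≤ Metric.infDist (x₀ + (ρ + δ) • u) K := by
  obtain ⟨k, hk, he⟩ := hKfin.isCompact.exists_infDist_eq_dist hKne (x₀ + (ρ + δ) • u)
  rw [he]
  exact le_trans (by linarith [Metric.infDist_le_dist_of_mem (x := x₀ + ρ • u) hk]) (radial_slope hu (hK k hk) hρ hδ)

/-- radius of a ray point. -/
theorem dist_ray_pt {x₀ u : E3} (hu : ‖u‖ = 1) {ρ : ℝ} (hρ : 0 ≤ ρ) : dist (x₀ + ρ • u) x₀ = ρ := by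
  rw [dist_eq_norm, add_sub_cancel_left, norm_smul, Real.norm_of_nonneg hρ, hu, mul_one]

/-- the potential is at least the radius minus `4`. -/
theorem dist_sub_four_le_infDist {K : Set E3} {p x₀ : E3} (hKne : K.Nonempty) (hK : ∀ k ∈ K, dist k x₀ ≤ 4) :
    dist p x₀ - 4 ≤ Metric.infDist p K := by
  rw [Metric.le_infDist hKne]
  intro k hk
  linarith [dist_triangle p k x₀, hK k hk]

/-! ### ZZY-2  Level points of the potential -/

/-- ★ LEVEL POINT ON A RAY: every ray from `x₀` meets the level surface `{φ = M}` (`4 < M`). -/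
theorem exists_level_radius {K : Set E3} {x₀ u : E3} (hKne : K.Nonempty) (hK : ∀ k ∈ K, dist k x₀ ≤ 4)
    (hu : ‖u‖ = 1) {M : ℝ} (hM : 4 < M) : ∃ ρ : ℝ, 0 ≤ ρ ∧ Metric.infDist (x₀ + ρ • u) K = M := by
  have hcont : Continuous fun ρ : ℝ => Metric.infDist (x₀ + ρ • u) K :=
    (Metric.continuous_infDist_pt K).comp (continuous_const.add (continuous_id.smul continuous_const))
  obtain ⟨k, hk⟩ := hKne
  have h0 : Metric.infDist (x₀ + (0 : ℝ) • u) K ≤ M := by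
    rw [zero_smul, add_zero]
    linarith [Metric.infDist_le_dist_of_mem (x := x₀) hk, hK k hk, dist_comm x₀ k]
  have h1 : M ≤ Metric.infDist (x₀ + (M + 5) • u) K := by
    have := dist_sub_four_le_infDist (p := x₀ + (M + 5) • u) ⟨k, hk⟩ hK
    rw [dist_ray_pt hu (by linarith)] at this
    linarith
  obtain ⟨ρ, hρ, he⟩ := intermediate_value_Icc (by linarith : (0 : ℝ) ≤ M + 5) hcont.continuousOn ⟨h0, h1⟩
  exact ⟨ρ, hρ.1, he⟩

/-- radius bounds of a level point: `M − 4 ≤ ρ ≤ M + 4`. -/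
theorem level_radius_bounds {K : Set E3} {x₀ u : E3} (hKne : K.Nonempty) (hK : ∀ k ∈ K, dist k x₀ ≤ 4)
    (hu : ‖u‖ = 1) {ρ M : ℝ} (hρ : 0 ≤ ρ) (he : Metric.infDist (x₀ + ρ • u) K = M) : M - 4 ≤ ρ ∧ ρ ≤ M + 4 := by
  have h1 := dist_sub_four_le_infDist (p := x₀ + ρ • u) hKne hK
  have h2 := infDist_sub_four_le_dist (p := x₀ + ρ • u) hKne hK
  rw [dist_ray_pt hu hρ, he] at h1 h2
  exact ⟨by linarith, by linarith⟩

/-- ★ LEVEL POINTS ON NEARBY RAYS ARE CLOSE: `dist t_u t_v ≤ (9/4)·ρ_u·‖u − v‖` for level-`M` points (`14 ≤ M`). -/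
theorem dist_level_points_le {K : Set E3} {x₀ u v : E3} (hKfin : K.Finite) (hKne : K.Nonempty)
    (hK : ∀ k ∈ K, dist k x₀ ≤ 4) (hu : ‖u‖ = 1) (hv : ‖v‖ = 1) {ρu ρv M : ℝ} (hM : 14 ≤ M)
    (hρu : 0 ≤ ρu) (hρv : 0 ≤ ρv) (heu : Metric.infDist (x₀ + ρu • u) K = M) (hev : Metric.infDist (x₀ + ρv • v) K = M) :
    dist (x₀ + ρu • u) (x₀ + ρv • v) ≤ 9 / 4 * (ρu * ‖u - v‖) := by
  have hbu := level_radius_bounds hKne hK hu hρu heu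
  have hbv := level_radius_bounds hKne hK hv hρv hev
  -- the comparison point `s = x₀ + ρu • v` on the ray `v`
  have hη : dist (x₀ + ρu • u) (x₀ + ρu • v) = ρu * ‖u - v‖ := by
    rw [dist_eq_norm, add_sub_add_left_eq_sub, ← smul_sub, norm_smul, Real.norm_of_nonneg hρu]
  have hs1 : Metric.infDist (x₀ + ρu • v) K ≤ M + ρu * ‖u - v‖ := by
    have := Metric.infDist_le_infDist_add_dist (s := K) (x := x₀ + ρu • v) (y := x₀ + ρu • u)
    rw [dist_comm, hη, heu] at this; exact this
  have hs2 : M - ρu * ‖u - v‖ ≤ Metric.infDist (x₀ + ρu • v) K := by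
    have := Metric.infDist_le_infDist_add_dist (s := K) (x := x₀ + ρu • u) (y := x₀ + ρu • v)
    rw [hη, heu] at this; linarith
  -- `|ρu − ρv| ≤ (5/4)·η` by the radial slope along the ray `v`
  have hdiff : |ρu - ρv| ≤ 5 / 4 * (ρu * ‖u - v‖) := by
    rw [abs_le]
    constructor
    · -- `ρv ≤ ρu + (5/4)η`: else the slope from `s` up to `t_v` overshoots `M`
      by_contra hcon
      push Not at hcon
      have hslope := infDist_radial_slope hKfin hKne hK hv (ρ := ρu) (δ := ρv - ρu) (by linarith) (by linarith)
      rw [show ρu + (ρv - ρu) = ρv by ring, hev] at hslope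
      linarith
    · -- `ρu ≤ ρv + (5/4)η`: else the slope from `t_v` up to `s` overshoots `M + η`
      by_contra hcon
      push Not at hcon
      have hslope := infDist_radial_slope hKfin hKne hK hv (ρ := ρv) (δ := ρu - ρv) (by linarith) (by linarith)
      rw [hev, show ρv + (ρu - ρv) = ρu by ring] at hslope
      linarith
  have hvs : dist (x₀ + ρu • v) (x₀ + ρv • v) = |ρu - ρv| := by
    rw [dist_eq_norm, add_sub_add_left_eq_sub, ← sub_smul, norm_smul, hv, mul_one, Real.norm_eq_abs]
  calc dist (x₀ + ρu • u) (x₀ + ρv • v)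
      ≤ dist (x₀ + ρu • u) (x₀ + ρu • v) + dist (x₀ + ρu • v) (x₀ + ρv • v) := dist_triangle _ _ _
    _ ≤ ρu * ‖u - v‖ + 5 / 4 * (ρu * ‖u - v‖) := by rw [hη, hvs]; exact add_le_add le_rfl hdiff
    _ = 9 / 4 * (ρu * ‖u - v‖) := by ring

/-- ★ THE HOP: an atom with potential in `(M, M + 17/16]` (`14 ≤ M`) is within `85/64` of every level-`M` point on its own ray. -/
theorem hop_le {K : Set E3} {x₀ P : E3} (hKfin : K.Finite) (hKne : K.Nonempty) (hK : ∀ k ∈ K, dist k x₀ ≤ 4)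
    {M : ℝ} (hM : 14 ≤ M) (hP1 : M < Metric.infDist P K) (hP2 : Metric.infDist P K ≤ M + 17 / 16)
    {ρ₀ : ℝ} (hρ₀ : 0 ≤ ρ₀) (he : Metric.infDist (x₀ + ρ₀ • (‖P - x₀‖⁻¹ • (P - x₀))) K = M) :
    dist P (x₀ + ρ₀ • (‖P - x₀‖⁻¹ • (P - x₀))) ≤ 85 / 64 := by
  have hrad : 10 ≤ dist P x₀ := by linarith [infDist_sub_four_le_dist (p := P) hKne hK]
  have hP0 : P - x₀ ≠ 0 := by
    intro h; rw [dist_eq_norm, h, norm_zero] at hrad; linarith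
  set u := ‖P - x₀‖⁻¹ • (P - x₀) with hu'
  have hu : ‖u‖ = 1 := norm_smul_inv_norm hP0
  have hPu : P = x₀ + dist P x₀ • u := by
    rw [hu', smul_smul, dist_eq_norm, mul_inv_cancel₀ (norm_ne_zero_iff.2 hP0), one_smul]; abel
  have hb0 := level_radius_bounds hKne hK hu hρ₀ he
  -- `ρ₀ ≤ dist P x₀`: else the slope from `P` up to the level point overshoots `M`
  have hle : ρ₀ ≤ dist P x₀ := by
    by_contra hcon
    push Not at hcon
    have hslope := infDist_radial_slope hKfin hKne hK hu (ρ := dist P x₀) (δ := ρ₀ - dist P x₀) hrad (by linarith)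
    rw [show dist P x₀ + (ρ₀ - dist P x₀) = ρ₀ by ring, he, ← hPu] at hslope
    linarith
  -- and `dist P x₀ − ρ₀ ≤ (5/4)·(17/16)` by the slope from the level point up to `P`
  have hslope := infDist_radial_slope hKfin hKne hK hu (ρ := ρ₀) (δ := dist P x₀ - ρ₀) (by linarith) (by linarith)
  rw [show ρ₀ + (dist P x₀ - ρ₀) = dist P x₀ by ring, he, ← hPu] at hslope
  have hd : dist P (x₀ + ρ₀ • u) = dist P x₀ - ρ₀ := by
    conv_lhs => rw [hPu]
    rw [dist_eq_norm, add_sub_add_left_eq_sub, ← sub_smul, norm_smul, hu, mul_one, Real.norm_of_nonneg (by linarith)]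
  rw [hd]; linarith

/-! ### ZZY-3  Chains of directions -/

/-- normalisation is `2/‖a‖`-Lipschitz: `‖a/‖a‖ − b/‖b‖‖ ≤ 2‖a − b‖/‖a‖`. [formal bookkeeping] -/
theorem norm_normalize_sub_le {a b : E3} (ha : a ≠ 0) (hb : b ≠ 0) :
    ‖‖a‖⁻¹ • a - ‖b‖⁻¹ • b‖ ≤ 2 * ‖a - b‖ / ‖a‖ := by
  have hA : 0 < ‖a‖ := norm_pos_iff.2 ha
  have hB : 0 < ‖b‖ := norm_pos_iff.2 hb
  have hsplit : ‖a‖⁻¹ • a - ‖b‖⁻¹ • b = ‖a‖⁻¹ • (a - b) + (‖a‖⁻¹ - ‖b‖⁻¹) • b := by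
    rw [smul_sub, sub_smul]; abel
  have hA0 : ‖a‖ ≠ 0 := hA.ne'
  have hB0 : ‖b‖ ≠ 0 := hB.ne'
  have h2 : ‖(‖a‖⁻¹ - ‖b‖⁻¹) • b‖ ≤ ‖a - b‖ / ‖a‖ := by
    have key : ‖(‖a‖⁻¹ - ‖b‖⁻¹) • b‖ = |‖b‖ - ‖a‖| / ‖a‖ := by
      rw [norm_smul, Real.norm_eq_abs, show ‖a‖⁻¹ - ‖b‖⁻¹ = (‖b‖ - ‖a‖) / (‖a‖ * ‖b‖) by field_simp, abs_div,
        abs_of_pos (mul_pos hA hB), div_mul_eq_mul_div, mul_div_mul_right _ _ hB0]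
    rw [key]
    exact div_le_div_of_nonneg_right (by rw [norm_sub_rev a b]; exact abs_norm_sub_norm_le b a) hA.le
  calc ‖‖a‖⁻¹ • a - ‖b‖⁻¹ • b‖ = ‖‖a‖⁻¹ • (a - b) + (‖a‖⁻¹ - ‖b‖⁻¹) • b‖ := by rw [hsplit]
    _ ≤ ‖‖a‖⁻¹ • (a - b)‖ + ‖(‖a‖⁻¹ - ‖b‖⁻¹) • b‖ := norm_add_le _ _
    _ ≤ ‖a - b‖ / ‖a‖ + ‖a - b‖ / ‖a‖ := by
        rw [norm_smul, Real.norm_of_nonneg (inv_nonneg.2 hA.le), inv_mul_eq_div]; exact add_le_add le_rfl h2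
    _ = 2 * ‖a - b‖ / ‖a‖ := by ring

/-- the linear interpolation of unit vectors at inner product `≥ −3/5` stays `≥ 2/5` in norm. -/
theorem norm_interp_ge {a b : E3} (ha : ‖a‖ = 1) (hb : ‖b‖ = 1) (hab : -(3 / 5) ≤ ⟪a, b⟫) {s : ℝ}
    (hs0 : 0 ≤ s) (hs1 : s ≤ 1) : 2 / 5 ≤ ‖(1 - s) • a + s • b‖ := by
  have hsq : ‖(1 - s) • a + s • b‖ ^ 2 = (1 - s) ^ 2 + 2 * ((1 - s) * s * ⟪a, b⟫) + s ^ 2 := by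
    rw [norm_add_sq_real, norm_smul, norm_smul, ha, hb, mul_one, mul_one, Real.norm_eq_abs, Real.norm_eq_abs,
      sq_abs, sq_abs, real_inner_smul_left, real_inner_smul_right]
    ring
  have h : (2 / 5 : ℝ) ^ 2 ≤ ‖(1 - s) • a + s • b‖ ^ 2 := by
    rw [hsq]
    nlinarith [mul_nonneg (mul_nonneg (sub_nonneg.2 hs1) hs0) (by linarith : (0 : ℝ) ≤ ⟪a, b⟫ + 3 / 5),
      sq_nonneg (s - 1 / 2)]
  exact (pow_le_pow_iff_left₀ (by norm_num) (norm_nonneg _) two_ne_zero).1 h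

/-- ★ ONE-LEG DIRECTION CHAIN: unit `a, b` with `⟪a, b⟫ ≥ −3/5` are joined by a chain of unit vectors with steps `≤ 10/N`, for every `N ≥ 1`. -/
theorem exists_dir_chain {a b : E3} (ha : ‖a‖ = 1) (hb : ‖b‖ = 1) (hab : -(3 / 5) ≤ ⟪a, b⟫) {N : ℕ} (hN : 1 ≤ N) :
    ∃ c : ℕ → E3, c 0 = a ∧ c N = b ∧ (∀ i, ‖c i‖ = 1) ∧ ∀ i < N, ‖c i - c (i + 1)‖ ≤ 10 / N := by
  have hN0 : (0 : ℝ) < N := by exact_mod_cast hN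
  -- interpolation parameter, clamped at `1`
  set s : ℕ → ℝ := fun i => min ((i : ℝ) / N) 1 with hs
  have hs0 : ∀ i, 0 ≤ s i := fun i => le_min (by positivity) zero_le_one
  have hs1 : ∀ i, s i ≤ 1 := fun i => min_le_right _ _
  have hsd : ∀ i, |s i - s (i + 1)| ≤ 1 / N := by
    intro i
    have h1 : s i ≤ s (i + 1) := min_le_min_right _ (by push_cast; gcongr; linarith)
    have h2 : s (i + 1) ≤ s i + 1 / N := by
      simp only [hs]
      rcases le_total ((i : ℝ) / N) 1 with h | h
      · rw [min_eq_left h]; push_cast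
        exact (min_le_left _ _).trans (by rw [add_div])
      · rw [min_eq_right h]; exact (min_le_right _ _).trans (le_add_of_nonneg_right (by positivity))
    rw [abs_sub_comm, abs_of_nonneg (by linarith)]; linarith
  set γ : ℕ → E3 := fun i => (1 - s i) • a + s i • b with hγ
  have hγn : ∀ i, 2 / 5 ≤ ‖γ i‖ := fun i => norm_interp_ge ha hb hab (hs0 i) (hs1 i)
  have hγ0 : ∀ i, γ i ≠ 0 := fun i h => by have := hγn i; rw [h, norm_zero] at this; linarith
  refine ⟨fun i => ‖γ i‖⁻¹ • γ i, ?_, ?_, fun i => norm_smul_inv_norm (hγ0 i), ?_⟩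
  · have : s 0 = 0 := by simp [hs]
    simp only [hγ, this]; rw [sub_zero, one_smul, zero_smul, add_zero, ha, inv_one, one_smul]
  · have : s N = 1 := by simp [hs, div_self hN0.ne']
    simp only [hγ, this]; rw [sub_self, zero_smul, zero_add, one_smul, hb, inv_one, one_smul]
  · intro i hi
    have hstep : ‖γ i - γ (i + 1)‖ ≤ 2 * |s i - s (i + 1)| := by
      have : γ i - γ (i + 1) = (s i - s (i + 1)) • (b - a) := by
        simp only [hγ]; module
      rw [this, norm_smul, Real.norm_eq_abs]
      have : ‖b - a‖ ≤ 2 := (norm_sub_le _ _).trans (by rw [ha, hb]; norm_num)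
      nlinarith [abs_nonneg (s i - s (i + 1))]
    calc ‖‖γ i‖⁻¹ • γ i - ‖γ (i + 1)‖⁻¹ • γ (i + 1)‖ ≤ 2 * ‖γ i - γ (i + 1)‖ / ‖γ i‖ :=
          norm_normalize_sub_le (hγ0 i) (hγ0 (i + 1))
      _ ≤ 2 * (2 * (1 / N)) / (2 / 5) := by
          rw [div_le_div_iff₀ (by linarith [hγn i]) (by norm_num)]
          nlinarith [hγn i, hsd i, hstep, abs_nonneg (s i - s (i + 1)), norm_nonneg (γ i - γ (i + 1)), norm_nonneg (γ i)]
      _ = 10 / N := by ring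

/-- ★ MID DIRECTION: any two unit vectors are within inner product `≥ −3/5` of a common unit vector. -/
theorem exists_mid_direction {u v : E3} (hu : ‖u‖ = 1) (hv : ‖v‖ = 1) :
    ∃ w : E3, ‖w‖ = 1 ∧ -(3 / 5) ≤ ⟪u, w⟫ ∧ -(3 / 5) ≤ ⟪w, v⟫ := by
  by_cases h1 : -(3 / 5) ≤ ⟪u, v⟫
  · exact ⟨v, hv, h1, by rw [real_inner_self_eq_norm_sq, hv]; norm_num⟩
  push Not at h1
  by_cases h2 : u + v = 0
  · -- antipodal: take a unit vector orthogonal to `u`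
    have hu0 : u ≠ 0 := by intro h; rw [h, norm_zero] at hu; exact zero_ne_one hu
    have hne : (ℝ ∙ u)ᗮ ≠ ⊥ := by
      intro h
      rw [Submodule.orthogonal_eq_bot_iff] at h
      have h3 : Module.finrank ℝ (ℝ ∙ u) = 3 := by rw [h, finrank_top, finrank_euclideanSpace_fin]
      have h1 : Module.finrank ℝ (ℝ ∙ u) = 1 := finrank_span_singleton hu0
      omega
    obtain ⟨w₀, hw₀, hw₀0⟩ := (Submodule.ne_bot_iff _).1 hne
    have horth : ⟪u, w₀⟫ = 0 := (Submodule.mem_orthogonal_singleton_iff_inner_right).1 hw₀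
    have hvu : v = -u := by rw [← sub_eq_zero, sub_neg_eq_add, add_comm]; exact h2
    refine ⟨‖w₀‖⁻¹ • w₀, norm_smul_inv_norm hw₀0, ?_, ?_⟩
    · rw [real_inner_smul_right, horth, mul_zero]; norm_num
    · rw [hvu, inner_neg_right, real_inner_smul_left, real_inner_comm, horth, mul_zero, neg_zero]; norm_num
  · -- otherwise the normalised bisector
    have hm : 0 < ‖u + v‖ := norm_pos_iff.2 h2
    have huv : ⟪u, u + v⟫ = 1 + ⟪u, v⟫ := by rw [inner_add_right, real_inner_self_eq_norm_sq, hu, one_pow]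
    have hvu : ⟪u + v, v⟫ = ⟪u, v⟫ + 1 := by rw [inner_add_left, real_inner_self_eq_norm_sq, hv, one_pow]
    have hcs : -1 ≤ ⟪u, v⟫ := by
      have := neg_le_of_abs_le (abs_real_inner_le_norm u v); rw [hu, hv, mul_one] at this; exact this
    refine ⟨‖u + v‖⁻¹ • (u + v), norm_smul_inv_norm h2, ?_, ?_⟩
    · rw [real_inner_smul_right, huv]
      have : 0 ≤ ‖u + v‖⁻¹ * (1 + ⟪u, v⟫) := mul_nonneg (inv_nonneg.2 hm.le) (by linarith)
      linarith
    · rw [real_inner_smul_left, hvu]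
      have : 0 ≤ ‖u + v‖⁻¹ * (⟪u, v⟫ + 1) := mul_nonneg (inv_nonneg.2 hm.le) (by linarith)
      linarith

end Summit.AtomisticToContinuum.Crystallization.Theorems.ChartedZeroExcessLayeredLatticeLiouville

end
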